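import Summits.Ventures.QEC.Census.CertCoverBatch
import Summits.Ventures.QEC.Census.BB.S8_126_w6_k12_01061B01.CoreDefs
import HarnessLib

set_option Elab.async false
set_option maxRecDepth 200000

/-!
# `[[252,12,16]]` one-level cover certificate of `S8_126_w6_k12_01061B01` — LEVEL-1→0 coset problems 40…53 (deep problems [0] excluded: `ProbDeep*.lean`) as COMPACT data
(`ProbData`: U, f, σ, y₀, allow; qec-type-10 `CertCoverBatch.mkCoset` rebuilds each `CosetProb` in the kernel) + their verdict
`probsOK cov covR hx hx1 D1 lxd 14` (one `decide +kernel`; 14 problems, depths f=0:10 f=1:3 f=2:1 f=3:0, est. 99.0 s).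
qec-search-1 g5 (pattern of search-9 g5 `Probs*`); data from JSON `level10.problems` (sha256 75f002ace624d82a…). Data + decided check; KERNEL.
-/

namespace Summit.Ventures.QEC.Census.S8_126_w6_k12_01061B01

open Matrix Summit.Ventures.QEC.Census Literature.InformationTheory.QuantumCodes

/-- Problems 40…53 (14): `⟨U, f, σ, y₀, allow⟩`. -/
def probs04 : List ProbData := [
    ⟨198109139144776713129930785792, 2, 292328312832, 158456362807460538419127517184, [0, 1152921504606846976]⟩,
    ⟨198109252523077477266774037504, 0, 4616191010968457216, 39652927457655313657389122560, [0]⟩,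
    ⟨198133322383535629320557954112, 0, 141167253524736, 39657616762961116097146782784, [0]⟩,
    ⟨198225158244528980473451906560, 1, 1127291763562496, 154742514165577377374068749, [1152921504606846976, 37778931862957161709568, 38685626227668133590597632]⟩,
    ⟨198496070964919372179982254080, 0, 2254291198803968, 39730223147635236892316270592, [0]⟩,
    ⟨396218231060123989765497291776, 1, 3462142523051347968, 316912687839447978120035958784, [0]⟩,
    ⟨396266578648175890668170773632, 0, 3462423723145957888, 79315205182499962939567506560, [0]⟩,
    ⟨396450420375355976281186369536, 0, 3459892922294468608, 317222172849271574988574425088, [0]⟩,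
    ⟨673439390829816019535962572288, 0, 4617316978546186240, 39614090715712200193091853316, []⟩,
    ⟨673632856739885097261166232576, 0, 4616189979110936576, 154780283842535783583973376, [0]⟩,
    ⟨792320320228593115560180450816, 0, 5769112566064224256, 633863985746106976679858536960, [0]⟩,
    ⟨792436414886206857018202915840, 1, 5770237366442659840, 158611105313524132475278721024, [0]⟩,
    ⟨792436528255284249118191391744, 0, 1154048848973287424, 633825460683798491452655272960, [0]⟩,
    ⟨1584640744329649188399361294337, 0, 1156301815986257924, 1267728056492504801454361411584, [0]⟩]

set_option maxHeartbeats 400000000 in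
/-- Every problem of this chunk passes (`mkCoset` elimination + `cosetOKD` + fast `σ` + depth + `BU`-evenness + label checks). -/
theorem probs04_ok : probsOK S8_126_w6_k12_01061B01.cov covR hx hx1 D1 lxd 14 probs04 = true := by
  decide +kernel

/-- Pointwise form. -/
theorem probs04_all : ∀ x ∈ S8_126_w6_k12_01061B01.probs04, probOK cov covR hx hx1 D1 lxd 14 x = true := by
  have h := probs04_ok
  rwa [probsOK, List.all_eq_true] at h

end Summit.Ventures.QEC.Census.S8_126_w6_k12_01061B01
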